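import Summits.ResolutionOfSingularities.ResolutionOfSingularities.Theorems.FrobeniusLadderFInjectiveMacaulayficationFCUnguardedAprime
import Summits.ResolutionOfSingularities.ResolutionOfSingularities.Theorems.FrobeniusLadderFInjectiveMacaulayficationWFixAtNonClosedDimTwo
import Literature.AlgebraicGeometry.Resolution.BlowupChartTransition
import Mathlib.RingTheory.Localization.LocalizationLocalization
import Mathlib.Algebra.Group.Pointwise.Set.ListOfFn
import HarnessLib

/-!
# The (A′) datum survives powers (`locFixDataFull_pow`) and the pow-assembly `fcUnguardedLowDim_of_aprime_pow`
# (crux `FInjectiveMacaulayfication` stmt-ResolutionOfSingularities-15315, chain w45a; res-L1-w45a-plan-1 R16.14 (i)(ii) / R16.15 (2a);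
# residual of record (T3′-pow) `FCUnguardedAprime.RelClosedSubsetFixPow` after res-L1-w45a-tri-2 20:14:32Z (c) / 20:15:37Z)

[OURS · L1 W4.5a · res-L1-w45a-stub-3] Support file (`--supports stmt-ResolutionOfSingularities-15315 --as helper`) for the crux
`FrobeniusLadder.FInjectiveMacaulayfication`; NOT a statement of any manuscript; replaces the role of NOTHING in H. Hironaka's manuscript;
AI-written, weaker than expert review. No definition and no named fact is introduced (theorem-only file); the candidate statements (T1″) `LocFixFullAtNonClosed`, (T2′) `SpreadGoodAprime`, (T3′-pow) `RelClosedSubsetFixPow` and the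
target `FCUnguardedLowDim` are those of `…FCUnguardedAprime` (p566975, FC2Dim4Sig v0.7 text), consumed as hypotheses.

WHY. res-L1-w45a-tri-2's sharpening (20:14:32Z (c), 20:15:37Z): the natural constructions for the relative fix (T3′) are TOWERS
`Bl_K(Bl_{J₀} X₁) → X₁` with `K` cosupported over `Z`, which compose (Raynaud–Gruson / Stacks 080B) to ONE blow-up of `X₁` along `J₀^m · 𝔞`
with `𝔞 ≡ J₀`-power off `Z` — so the honest residual asks agreement off `Z` only up to a positive power, `stalkIdeal J x = (stalkIdeal J₀ x)ⁿ`
(`RelClosedSubsetFixPow`). The v0.7 assembly `fcUnguardedLowDim_of_aprime` transports the FULL datum `(c′)` at the single point `η` through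
`stalkIdeal J η = stalkIdeal J₀ η = (c′)`; with the power residual it reads `stalkIdeal J η = (c′)ⁿ`, and one needs a FULL datum GENERATING
`(c′)ⁿ`. This file supplies it:

* §1 `isLocalization_away_mul_chart` — for `g ∈ I`, `b ∈ Iᵏ`, the affine blowup algebra `R[I·Iᵏ/(g b)]` is the localisation of `R[I/g]`
  away from `b/gᵏ` along the transition map `blowupAlgebraMul` (Stacks 080A on charts: `Bl_{Iⁿ} = Bl_I`, the degree-`n` monomial chart
  `D₊(g b)` is the open piece `D(b/gᵏ)` of the degree-one chart `D₊(g)`); `fullCl_atPrime_of_isLocalization_away`,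
  `fullCl_charts_mul` — FULL-ness of all local rings descends to a localisation (`B''_{𝔔''} ≅ B_{𝔔'' ∩ B}`).
* §2 the degree-`(k+1)` monomials `fun t => ∏ i, c' (finFunctionFinEquiv.symm t i)` in a finite family (inline, no def):
  `span_monomials : (monomials) = (c′)ᵏ⁺¹`, `fullCl_charts_monomials`.
* §3 **`locFixDataFull_pow`** — a FULL (A′) datum `(c′)` at `η` (reduced `𝒪_η`) yields the FULL (A′) datum of degree-`(k+1)` monomials generating
  `(c′)ᵏ⁺¹` (plan-1 R16.14 (i); `locFixDataFull_pow'` is the `0 < n` form). Reducedness is needed only for `(c′)ᵏ⁺¹ ≠ ⊥`.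
* §4 **`fcUnguardedLowDim_of_aprime_pow : LocFixFullAtNonClosed → SpreadGoodAprime → RelClosedSubsetFixPow → FCUnguardedLowDim`**
  (plan-1 R16.14 (ii)), sorry-free; §5 `fcUnguarded_of_parts_pow` — the splitter of `…FCUnguardedAprime` §4 with the power residual, for
  res-L1-w45a-lead-1's door v31 registration.

References: The Stacks Project, Tags 080A (blowing up a product of ideals; charts), 0804 (affine charts of a blowing up), 052Q (the affine
blowup algebra). Everything here is [folklore] bookkeeping over the tree's `blowupAlgebra` / `blowupAlgebraMul` / `awayMul` API
(`AffineBlowupAlgebra`, `BlowupChartModule`, `BlowupChartTransition`) and Mathlib's localisation-of-a-localisation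
(`IsLocalization.isLocalization_isLocalization_atPrime_isLocalization`).
-/

-- single-problem summit: the doubled namespace component is forced
set_option linter.dupNamespace false

noncomputable section

open AlgebraicGeometry CategoryTheory Literature.AlgebraicGeometry.Resolution TopologicalSpace IsLocalRing

namespace Summit.ResolutionOfSingularities.ResolutionOfSingularities.Theorems.FInjectiveMacaulayfication.FCUnguardedAprimePow

open Summit.ResolutionOfSingularities.ResolutionOfSingularities.Theorems.FInjectiveMacaulayfication
open Summit.ResolutionOfSingularities.ResolutionOfSingularities.Theorems.FInjectiveMacaulayfication.SliceableCentre (CMCl FCl FullCl)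
open Pointwise

/-! ## §1 The chart `R[I·Iᵏ/(g·b)]` is the localisation of the chart `R[I/g]` away from `b/gᵏ` -/

section Chart

variable {R : Type} [CommRing R] (g b : R)

/-- The kernel of the transition `R[1/g] → R[1/(g b)]` is `b`-power torsion: `z ↦ 0` forces `bʲ · z = 0` in `R[1/g]`
for some `j`. [folklore] -/
theorem exists_pow_mul_eq_zero_of_awayMul_eq_zero {z : Localization.Away g} (hz : awayMul g b z = 0) :
    ∃ j : ℕ, algebraMap R (Localization.Away g) (b ^ j) * z = 0 := by
  induction z using Localization.induction_on with
  | H y =>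
    obtain ⟨r, ⟨_, n, rfl⟩⟩ := y
    dsimp only at hz ⊢
    rw [awayMul_mk, Localization.mk_eq_mk', IsLocalization.mk'_eq_zero_iff] at hz
    obtain ⟨⟨_, j, rfl⟩, hj⟩ := hz
    refine ⟨j + n, ?_⟩
    rw [Localization.mk_eq_mk', IsLocalization.mul_mk'_eq_mk'_of_mul, IsLocalization.mk'_eq_zero_iff]
    refine ⟨⟨g ^ j, j, rfl⟩, ?_⟩
    calc (g ^ j * (b ^ (j + n) * r) : R) = (g * b) ^ j * (r * b ^ n) := by ring
      _ = 0 := hj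

variable {g b} {I : Ideal R} {k : ℕ}

/-- **The degree-`(k+1)` monomial chart is an open piece of a degree-one chart** (Stacks 080A/0804, `Bl_{Iⁿ} = Bl_I`): for `g ∈ I` and
`b ∈ Iᵏ`, the affine blowup algebra `R[I·Iᵏ/(g b)] ⊆ R[1/(g b)]` is the localisation of `R[I/g] ⊆ R[1/g]` away from `u = b/gᵏ ∈ R[I/g]`,
along the transition map `blowupAlgebraMul` (`x/g ↦ x b/(g b)`). Proof: `u ↦ b·bᵏ/(gb)ᵏ` has inverse `gᵏ⁺¹/(g b)`; `y/(gb)ᴺ` (`y ∈ (I·Iᵏ)ᴺ =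
I^{(k+1)N}`) is the image of `y/g^{(k+1)N}` divided by `uᴺ`; and the kernel of `R[1/g] → R[1/(gb)]` is `b`-power torsion, `bʲ = uʲ · g^{kj}`.
[cite: StacksProject, Tag 080A] -/
theorem isLocalization_away_mul_chart (hg : g ∈ I) (hb : b ∈ I ^ k) :
    @IsLocalization.Away (blowupAlgebra I g) _ (blowupAlgebra.divPow I g hb)
      (blowupAlgebra (I * I ^ k) (g * b)) _ (blowupAlgebraMul I (I ^ k) g b hb).toAlgebra := by
  letI : Algebra (blowupAlgebra I g) (blowupAlgebra (I * I ^ k) (g * b)) := (blowupAlgebraMul I (I ^ k) g b hb).toAlgebra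
  have hφ : ∀ z : blowupAlgebra I g,
      ((algebraMap (blowupAlgebra I g) (blowupAlgebra (I * I ^ k) (g * b)) z : blowupAlgebra (I * I ^ k) (g * b)) :
        Localization.Away (g * b)) = awayMul g b (z : Localization.Away g) := fun z => rfl
  refine IsLocalization.Away.mk _ ?_ ?_ ?_
  · -- `u = b/gᵏ` becomes a unit, with inverse `gᵏ⁺¹/(g b)`
    have hmem : g ^ (k + 1) ∈ I * I ^ k := by
      rw [pow_succ']
      exact Ideal.mul_mem_mul hg (Ideal.pow_mem_pow hg k)
    refine IsUnit.of_mul_eq_one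
      (⟨algebraMap R (Localization.Away (g * b)) (g ^ (k + 1)) * IsLocalization.Away.invSelf (g * b),
        div_mem_blowupAlgebra _ _ hmem⟩ : blowupAlgebra (I * I ^ k) (g * b)) (Subtype.ext ?_)
    have h1 := algebraMap_pow_mul_invSelf_pow (g * b) (k + 1)
    have h2 : algebraMap R (Localization.Away (g * b)) ((g * b) ^ (k + 1)) =
        algebraMap R (Localization.Away (g * b)) b * algebraMap R (Localization.Away (g * b)) (b ^ k) *
          algebraMap R (Localization.Away (g * b)) (g ^ (k + 1)) := by
      rw [← map_mul, ← map_mul]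
      congr 1
      ring
    rw [h2, pow_succ (IsLocalization.Away.invSelf (g * b)) k] at h1
    rw [MulMemClass.coe_mul, hφ, blowupAlgebra.coe_divPow, map_mul, awayMul_algebraMap, awayMul_invSelf_pow,
      OneMemClass.coe_one]
    linear_combination h1
  · -- every `y/(gb)ᴺ`, `y ∈ (I·Iᵏ)ᴺ`, is `(y/g^{(k+1)N}) · u⁻ᴺ`
    intro s
    have hgb : g * b ∈ I * I ^ k := Ideal.mul_mem_mul hg hb
    obtain ⟨N, y, hy, hs⟩ := blowupAlgebra.exists_eq_mul_invSelf_pow (I * I ^ k) (g * b) hgb s.2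
    have hy' : y ∈ I ^ ((k + 1) * N) := by
      rw [pow_mul, pow_succ']
      exact hy
    refine ⟨N, blowupAlgebra.divPow I g hy', Subtype.ext ?_⟩
    simp only [MulMemClass.coe_mul, SubmonoidClass.coe_pow, hφ, blowupAlgebra.coe_divPow, hs, map_mul, map_pow,
      awayMul_algebraMap, awayMul_invSelf]
    ring
  · -- the kernel of the transition is `u`-power torsion
    intro a a' h
    have h' : awayMul g b ((a : Localization.Away g) - a') = 0 := by
      rw [map_sub, sub_eq_zero]
      exact congrArg Subtype.val h
    obtain ⟨j, hj⟩ := exists_pow_mul_eq_zero_of_awayMul_eq_zero g b h'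
    refine ⟨j, Subtype.ext ?_⟩
    rw [MulMemClass.coe_mul, MulMemClass.coe_mul, SubmonoidClass.coe_pow, blowupAlgebra.coe_divPow, ← sub_eq_zero,
      ← mul_sub]
    calc (algebraMap R (Localization.Away g) b * IsLocalization.Away.invSelf g ^ k) ^ j *
          ((a : Localization.Away g) - a')
        = (IsLocalization.Away.invSelf g ^ k) ^ j *
            (algebraMap R (Localization.Away g) (b ^ j) * ((a : Localization.Away g) - a')) := by
          rw [map_pow]; ring
      _ = 0 := by rw [hj, mul_zero]

/-- `FullCl` at every prime descends along a localisation: if `B''` is a localisation of `B` (away from `u`) and every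
`B_𝔔` is FULL, then every `B''_{𝔔''}` is FULL (`B''_{𝔔''} ≅ B_{𝔔'' ∩ B}`). [folklore] -/
theorem fullCl_atPrime_of_isLocalization_away (p : ℕ) {B B'' : Type} [CommRing B] [CommRing B''] [Algebra B B''] (u : B)
    [IsLocalization.Away u B''] (h : ∀ 𝔔 : PrimeSpectrum B, FullCl p (Localization.AtPrime 𝔔.asIdeal))
    (𝔔'' : PrimeSpectrum B'') : FullCl p (Localization.AtPrime 𝔔''.asIdeal) := by
  haveI : IsLocalization.AtPrime (Localization.AtPrime 𝔔''.asIdeal) (𝔔''.asIdeal.comap (algebraMap B B'')) :=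
    IsLocalization.isLocalization_isLocalization_atPrime_isLocalization (Submonoid.powers u)
      (Localization.AtPrime 𝔔''.asIdeal) 𝔔''.asIdeal
  exact WFixAtNonClosedDimTwo.fullCl_of_ringEquiv p
    (IsLocalization.algEquiv (𝔔''.asIdeal.comap (algebraMap B B'')).primeCompl
      (Localization.AtPrime (𝔔''.asIdeal.comap (algebraMap B B''))) (Localization.AtPrime 𝔔''.asIdeal)).toRingEquiv
    (h ⟨𝔔''.asIdeal.comap (algebraMap B B''), Ideal.comap_isPrime _ _⟩)

/-- **FULL charts survive the passage to monomial charts**: if every local ring of the chart `R[I/g]` is FULL, so is every local ring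
of the chart `R[I·Iᵏ/(g b)]`, `b ∈ Iᵏ` (an open piece of `Spec R[I/g]`). [folklore] -/
theorem fullCl_charts_mul (p : ℕ) (hg : g ∈ I) (hb : b ∈ I ^ k)
    (h : ∀ 𝔔 : PrimeSpectrum (blowupAlgebra I g), FullCl p (Localization.AtPrime 𝔔.asIdeal))
    (𝔔'' : PrimeSpectrum (blowupAlgebra (I * I ^ k) (g * b))) : FullCl p (Localization.AtPrime 𝔔''.asIdeal) := by
  letI : Algebra (blowupAlgebra I g) (blowupAlgebra (I * I ^ k) (g * b)) := (blowupAlgebraMul I (I ^ k) g b hb).toAlgebra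
  haveI : IsLocalization.Away (blowupAlgebra.divPow I g hb) (blowupAlgebra (I * I ^ k) (g * b)) :=
    isLocalization_away_mul_chart hg hb
  exact fullCl_atPrime_of_isLocalization_away p (blowupAlgebra.divPow I g hb) h 𝔔''

/-- Index transport for the chart clause (the chart type depends on the ideal and the element). [plumbing] -/
theorem fullCl_charts_congr (p : ℕ) {J J' : Ideal R} {m m' : R} (hJ : J = J') (hm : m = m')
    (h : ∀ 𝔔 : PrimeSpectrum (blowupAlgebra J m), FullCl p (Localization.AtPrime 𝔔.asIdeal)) :
    ∀ 𝔔 : PrimeSpectrum (blowupAlgebra J' m'), FullCl p (Localization.AtPrime 𝔔.asIdeal) := by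
  subst hJ hm
  exact h

end Chart

/-! ## §2 The degree-`(k+1)` monomials in a finite family -/

section Monomials

variable {R : Type} [CommRing R] {n' : ℕ} (c' : Fin n' → R) (k : ℕ)

/-! The degree-`(k+1)` monomials `∏ᵢ c'_{w i}` in the family `c'` are indexed by `Fin (n' ^ (k+1))` through the words
`w : Fin (k+1) → Fin n'` (`finFunctionFinEquiv`); they are written inline as `fun t => ∏ i, c' (finFunctionFinEquiv.symm t i)` (no definition
is introduced). -/

/-- A monomial is `c'_{w 0}` times a degree-`k` monomial lying in `(c')ᵏ`. [folklore] -/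
theorem monomials_eq_mul (t : Fin (n' ^ (k + 1))) :
    ∃ b : R, b ∈ Ideal.span (Set.range c') ^ k ∧ (∏ i, c' (finFunctionFinEquiv.symm t i)) = c' (finFunctionFinEquiv.symm t 0) * b := by
  refine ⟨∏ i : Fin k, c' (finFunctionFinEquiv.symm t i.succ), ?_, Fin.prod_univ_succ _⟩
  have h := Ideal.prod_mem_prod (s := (Finset.univ : Finset (Fin k))) (I := fun _ => Ideal.span (Set.range c'))
    (x := fun i => c' (finFunctionFinEquiv.symm t i.succ)) (fun i _ => Ideal.subset_span ⟨_, rfl⟩)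
  rwa [Finset.prod_const, Finset.card_univ, Fintype.card_fin] at h

/-- The degree-`(k+1)` monomials generate `(c')ᵏ⁺¹`. [folklore] -/
theorem span_monomials : Ideal.span (Set.range (fun t : Fin (n' ^ (k + 1)) => ∏ i, c' (finFunctionFinEquiv.symm t i))) = Ideal.span (Set.range c') ^ (k + 1) := by
  apply le_antisymm
  · rw [Ideal.span_le]
    rintro _ ⟨t, rfl⟩
    have h := Ideal.prod_mem_prod (s := (Finset.univ : Finset (Fin (k + 1)))) (I := fun _ => Ideal.span (Set.range c'))
      (x := fun i => c' (finFunctionFinEquiv.symm t i)) (fun i _ => Ideal.subset_span ⟨_, rfl⟩)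
    rwa [Finset.prod_const, Finset.card_univ, Fintype.card_fin] at h
  · have hpow : Ideal.span (Set.range c') ^ (k + 1) = Ideal.span (Set.range c' ^ (k + 1)) :=
      Submodule.span_pow (Set.range c') (k + 1)
    rw [hpow, Ideal.span_le]
    intro a ha
    obtain ⟨f, hf⟩ := Set.mem_pow.mp ha
    have hw : ∀ i, ∃ j, c' j = (f i : R) := fun i => (f i).2
    choose w hw using hw
    refine Ideal.subset_span ⟨finFunctionFinEquiv w, ?_⟩
    rw [← hf, List.prod_ofFn]
    dsimp only
    rw [Equiv.symm_apply_apply]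
    exact Finset.prod_congr rfl fun i _ => hw i

/-- **FULL charts pass to the monomial charts of the power**: if every local ring of every chart `R[(c')/c'_j]` is FULL, then so is
every local ring of every chart `R[(c')ᵏ⁺¹/m]`, `m` a degree-`(k+1)` monomial. [folklore] -/
theorem fullCl_charts_monomials (p : ℕ)
    (h : ∀ (j : Fin n') (𝔔 : PrimeSpectrum (blowupAlgebra (Ideal.span (Set.range c')) (c' j))),
      FullCl p (Localization.AtPrime 𝔔.asIdeal))
    (t : Fin (n' ^ (k + 1))) (𝔔 : PrimeSpectrum (blowupAlgebra (Ideal.span (Set.range (fun t : Fin (n' ^ (k + 1)) => ∏ i, c' (finFunctionFinEquiv.symm t i))))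
      (∏ i, c' (finFunctionFinEquiv.symm t i)))) :
    FullCl p (Localization.AtPrime 𝔔.asIdeal) := by
  obtain ⟨b, hb, ht⟩ := monomials_eq_mul c' k t
  have hJ : Ideal.span (Set.range c') * Ideal.span (Set.range c') ^ k = Ideal.span (Set.range (fun t : Fin (n' ^ (k + 1)) => ∏ i, c' (finFunctionFinEquiv.symm t i))) := by
    rw [span_monomials, pow_succ']
  exact fullCl_charts_congr p hJ ht.symm
    (fullCl_charts_mul p (Ideal.subset_span ⟨_, rfl⟩) hb (h (finFunctionFinEquiv.symm t 0))) 𝔔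

end Monomials

/-! ## §3 `locFixDataFull_pow`: the FULL (A′) datum survives powers -/

/-- [OURS · L1 W4.5a · res-L1-w45a-plan-1 R16.14 (i)] **The FULL (A′) datum survives powers.** If `(c′)` is a FULL LocFix datum at `η`
(`(c′) ≠ ⊥`, `(c′) ≤ 𝔪_η`, every local ring of every chart `𝒪_η[(c′)/c′_j]` FULL) and `𝒪_{X₁,η}` is reduced, then the degree-`(k+1)`
monomials in `c′` form a FULL LocFix datum generating `(c′)ᵏ⁺¹`: `Bl_{Iⁿ} = Bl_I`, each monomial chart `𝒪_η[(c′)ᵏ⁺¹/(c′_{w₀}·b)]` being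
the localisation of the FULL chart `𝒪_η[(c′)/c′_{w₀}]` away from `b/c′_{w₀}ᵏ` (`isLocalization_away_mul_chart`), and FULL-ness of all
local rings descends to localisations. Reducedness is needed only for `(c′)ᵏ⁺¹ ≠ ⊥`. [folklore; cite: StacksProject, Tag 080A] -/
theorem locFixDataFull_pow {p : ℕ} {X₁ : Scheme.{0}} {η : X₁} [IsReduced (X₁.presheaf.stalk η)] {n' : ℕ}
    {c' : Fin n' → X₁.presheaf.stalk η} (h : FCUnguardedAprime.LocFixDataFull p X₁ η n' c') (k : ℕ) :
    FCUnguardedAprime.LocFixDataFull p X₁ η (n' ^ (k + 1)) (fun t : Fin (n' ^ (k + 1)) => ∏ i, c' (finFunctionFinEquiv.symm t i)) ∧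
      Ideal.span (Set.range (fun t : Fin (n' ^ (k + 1)) => ∏ i, c' (finFunctionFinEquiv.symm t i))) = Ideal.span (Set.range c') ^ (k + 1) := by
  obtain ⟨hne, hle, hfull⟩ := h
  refine ⟨⟨?_, ?_, fullCl_charts_monomials c' k p hfull⟩, span_monomials c' k⟩
  · -- `(c′)ᵏ⁺¹ ≠ ⊥` in the reduced ring `𝒪_η`
    rw [span_monomials]
    obtain ⟨x, hx, hx0⟩ := (Submodule.ne_bot_iff _).mp hne
    intro hbot
    have hxk : x ^ (k + 1) ∈ Ideal.span (Set.range c') ^ (k + 1) := Ideal.pow_mem_pow hx (k + 1)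
    rw [hbot, Ideal.mem_bot] at hxk
    exact hx0 (IsReduced.eq_zero x ⟨k + 1, hxk⟩)
  · rw [span_monomials, pow_succ']
    exact Ideal.mul_le_right.trans hle

/-- The `0 < n` form of `locFixDataFull_pow` (as ordered by res-L1-w45a-plan-1 R16.14 (i)): some FULL datum generating `(c′)ⁿ`. [plumbing] -/
theorem locFixDataFull_pow' {p : ℕ} {X₁ : Scheme.{0}} {η : X₁} [IsReduced (X₁.presheaf.stalk η)] {n' : ℕ}
    {c' : Fin n' → X₁.presheaf.stalk η} (h : FCUnguardedAprime.LocFixDataFull p X₁ η n' c') {n : ℕ} (hn : 0 < n) :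
    ∃ (n'' : ℕ) (c'' : Fin n'' → X₁.presheaf.stalk η), FCUnguardedAprime.LocFixDataFull p X₁ η n'' c'' ∧
      Ideal.span (Set.range c'') = Ideal.span (Set.range c') ^ n := by
  obtain ⟨k, rfl⟩ := Nat.exists_eq_succ_of_ne_zero hn.ne'
  exact ⟨_, _, locFixDataFull_pow h k⟩

/-! ## §4 The pow-assembly: FC″(≥4) at `η` of local dimension 2 or 3 ⇐ (T1″) + (T2′) + (T3′-pow) -/

/-- [OURS · L1 W4.5a · assembly, PROVED — res-L1-w45a-plan-1 R16.14 (ii) / R16.15 (2a)] **FC″(≥4) at a non-closed bad `η` with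
`2 ≤ dim 𝒪_η ≤ 3` from (T1″) + (T2′) + the POWER residual (T3′-pow) `RelClosedSubsetFixPow`.** As `FCUnguardedAprime.fcUnguardedLowDim_of_aprime`:
FULL datum `(c′)` at `η` (T1″); spread (T2′) to `J₀` with `stalkIdeal J₀ η = (c′)`, good over `supp J₀ ∩ U`, `η ∈ U`; `Z := supp J₀ ∖ U`
(closed, `∌ η`); (T3′-pow) gives `J` good over all of `supp J` with `stalkIdeal J x = (stalkIdeal J₀ x)ⁿ` off `Z`, `n = k + 1 > 0` — so
`stalkIdeal J η = (c′)ᵏ⁺¹`, which is generated by the degree-`(k+1)` monomials in `c′`, a FULL datum again (`locFixDataFull_pow`; `𝒪_η` is a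
domain since `X₁` is integral); hence `J ≠ ⊥`, `η ∈ supp J`, and FC″'s (A′), (nc), (cl) clauses verbatim. [folklore assembly, OURS; no named fact] -/
theorem fcUnguardedLowDim_of_aprime_pow (h₁ : FCUnguardedAprime.LocFixFullAtNonClosed) (h₂ : FCUnguardedAprime.SpreadGoodAprime) (h₃ : FCUnguardedAprime.RelClosedSubsetFixPow) :
    FCUnguardedAprime.FCUnguardedLowDim := by
  intro p hp k _ _ X₁ f₁ hs hft hqc hi h4 hCM η hη h2 h3
  obtain ⟨hηcl, hbad, hgen⟩ := hη
  obtain ⟨n', c', hfull⟩ := h₁ p hp k X₁ f₁ hs hft hqc hi h4 hCM η hηcl hbad h2 h3 hgen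
  obtain ⟨J₀, U, -, -, hstalk, hηU, hgood⟩ := h₂ p hp k X₁ f₁ hs hft hqc hi h4 hCM η n' c' hfull
  -- `Z := supp J₀ ∖ U`
  have hZcl : IsClosed ((J₀.support : Set X₁) \ (U : Set X₁)) := J₀.support.isClosed.sdiff U.isOpen
  have hZsub : (J₀.support : Set X₁) \ (U : Set X₁) ⊆ (J₀.support : Set X₁) := fun x hx => hx.1
  have hZeq : (J₀.support : Set X₁) \ ((J₀.support : Set X₁) \ (U : Set X₁)) = (J₀.support : Set X₁) ∩ (U : Set X₁) := by
    ext x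
    constructor
    · rintro ⟨hx, hx'⟩
      exact ⟨hx, by_contra fun hxU => hx' ⟨hx, hxU⟩⟩
    · rintro ⟨hx, hxU⟩
      exact ⟨hx, fun h => h.2 hxU⟩
  have hgoodZ : FCUnguardedAprime.GoodOver p X₁ J₀ ((J₀.support : Set X₁) \ ((J₀.support : Set X₁) \ (U : Set X₁))) := by
    rw [hZeq]
    exact hgood
  obtain ⟨J, n, hn, hJeq, hJgood⟩ := h₃ p hp k X₁ f₁ hs hft hqc hi h4 hCM J₀ _ hZcl hZsub hgoodZ
  obtain ⟨m, rfl⟩ := Nat.exists_eq_succ_of_ne_zero hn.ne'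
  -- the degree-`(m+1)` monomials in `c′`: a FULL datum generating `(c′)^{m+1} = stalkIdeal J η`
  obtain ⟨⟨hne, hle, hcharts⟩, hspan⟩ := locFixDataFull_pow hfull m
  have hηZ : η ∉ (J₀.support : Set X₁) \ (U : Set X₁) := fun h => h.2 hηU
  have hJη : stalkIdeal J η = Ideal.span (Set.range (fun t : Fin (n' ^ (m + 1)) => ∏ i, c' (finFunctionFinEquiv.symm t i))) := by
    rw [hJeq η hηZ, hstalk, hspan]
  refine ⟨J, n' ^ (m + 1), fun t => ∏ i, c' (finFunctionFinEquiv.symm t i), ?_, ?_, hne, hle, fun j 𝔔 _ => hcharts j 𝔔, hJη,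
    fun X₂ π hπ => ?_⟩
  · -- `J ≠ ⊥` since `J_η = (c′)^{m+1} ≠ ⊥`
    intro hJ
    apply hne
    rw [← hJη, hJ]
    exact stalkIdeal_bot η
  · -- `η ∈ supp J` since `J_η ≤ 𝔪_η`
    exact (mem_support_iff_stalkIdeal_le J η).mpr (by rw [hJη]; exact hle)
  · obtain ⟨hnc, hcl⟩ := hJgood X₂ π hπ
    exact ⟨fun x hx _ hxcl => hnc x hx hxcl, fun x hx hxcl => hcl x hx hxcl⟩

/-! ## §5 The pow splitter: door v30's `stub_fcUnguarded` through the (A′) route with the POWER residual -/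

/-- **DOOR v30's `stub_fcUnguarded` THROUGH THE (A′) ROUTE, POWER RESIDUAL** — `FCUnguardedAprime.fcUnguarded_of_parts` with (T3′) replaced
by the residual of record (T3′-pow) `RelClosedSubsetFixPow` (res-L1-w45a-plan-1 R16.14/R16.15; the decomposition door v31 registers).
[OURS assembly; plumbing] -/
theorem fcUnguarded_of_parts_pow (h2 : FCUnguardedRungs.FCUnguardedDimLe2) (h3 : FCUnguardedDimEq3.FCUnguardedDimEq3)
    (h₁ : FCUnguardedAprime.FCUnguardedLocDimLe1) (hT1 : FCUnguardedAprime.LocFixFullAtNonClosed)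
    (hT2 : FCUnguardedAprime.SpreadGoodAprime) (hT3 : FCUnguardedAprime.RelClosedSubsetFixPow)
    (h₄ : FCUnguardedAprime.FCUnguardedLocDimGe4) : GenericFibreReduction.FCUnguarded :=
  FCUnguardedRungs.fcUnguarded_of_rungs h2 h3
    (FCUnguardedAprime.fcUnguardedDimGe4_of_parts h₁ (fcUnguardedLowDim_of_aprime_pow hT1 hT2 hT3) h₄)

end Summit.ResolutionOfSingularities.ResolutionOfSingularities.Theorems.FInjectiveMacaulayfication.FCUnguardedAprimePow

end
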